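import Literature.AlgebraicGeometry.Resolution.Mulay1983Hyperplanarity
import Literature.AlgebraicGeometry.Resolution.Mulay1983SmoothHyperplanar
import Literature.AlgebraicGeometry.Resolution.Mulay1983LinearCoordinates
import Mathlib.FieldTheory.IsAlgClosed.AlgebraicClosure
import Mathlib.Algebra.MvPolynomial.Funext
import Mathlib.LinearAlgebra.Dual.Lemmas
import Mathlib.LinearAlgebra.Matrix.NonsingularInverse
import HarnessLib

/-!
# Discharge of the named fact `Mulay1983_codimTwoHyperplanar` (Mulay 1983, Main Theorem §4)

Topic: `Literature/AlgebraicGeometry/Resolution`. S. B. Mulay, *Equimultiplicity and hyperplanarity*,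
Proc. Amer. Math. Soc. **89** (1983) 407–413 (lit key `paper:url-29aeafb0cf6c`), §4 MAIN THEOREM
(p. 413): «Let `R` be an excellent regular local domain containing a field. Let `F` be a nonzero principal
ideal in `R`, contained in `m(R)`. Then the 2-codimensional equimultiple locus of `(R, F)` is
hyperplanar.» The named fact `Mulay1983_codimTwoHyperplanar` (`Mulay1983Hyperplanarity.lean`) is its
special case `R = K⟦X_{Fin d}⟧`, centres `(u_i, u_j)` cut out by two members of a regular system of
parameters. This file PROVES it (`Mulay1983_codimTwoHyperplanar_holds`), following the printed proof:

* 1.5 (p. 408) «extension of the ground field … the residue field of `R(x)` is infinite … `E` is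
  hyperplanar iff `E R(x)` is hyperplanar»: we extend scalars to the algebraic closure `L` of `K` and
  descend along a `K`-basis of `L` (`exists_mem_of_baseChange`);
* 2.6 (p. 410) «there exists a basis `(X₁, …, X_n)` of `m(R)` such that `FR ⊄ (X₁^{d+1}, X₂, …, X_n)R`»:
  over the infinite field `L` the initial form of `g` does not vanish identically
  (`MvPolynomial.funext`); a direction `e` with `in(g)(e) ≠ 0` lies outside the span `N` of the tangent
  planes' annihilators (`Mulay1983LinearCoordinates.eval_truncTotal_add_eq_of_mem_pow`), so a linear
  functional `λ` with `λ(e) = 1`, `λ|_N = 0` exists (`Submodule.exists_dual_map_eq_bot_of_notMem`) and lies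
  in every tangent plane (`mem_span_of_iInf_ker_le_ker`); the basis `(e, ker λ)` gives coordinates in which
  `g` is `x₀`-regular of order `d` (`coeff_single_subst_linSubst`) and every centre contains an element
  with linear part `x₀`;
* the core `Mulay1983SmoothHyperplanar.exists_forall_mem_of_smooth` (§§2–4: Weierstrass form,
  normal forms `(z − θ, q)`, finiteness 1.2, `Λ`-lemma 3.9) then yields `z + t`, transported back.

No statement of H. Hironaka's 2017 manuscript is involved. AI formalisation; weaker than expert
review. Consumer: `res-hironaka` L W2.2 (`UniformContactRegDim_three_of_mulay`).

## References
* S. B. Mulay, *Equimultiplicity and hyperplanarity*, Proc. Amer. Math. Soc. 89 (1983) 407–413,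
  1.5, 2.6, §4 Main Theorem. [Mulay1983]
-/

noncomputable section

namespace Literature.AlgebraicGeometry.Resolution

universe u

open IsLocalRing Literature.RingTheory.MvPowerSeries

namespace Mulay1983

/-! ## 1. Descent along a field extension (Mulay 1.5) -/

section Descent

variable {K L : Type u} [Field K] [Field L] [Algebra K L] {σ : Type}

/-- The linear part of a product with a series without constant term. [folklore] -/
private theorem coeff_single_one_mul' (o : σ) (r a : MvPowerSeries σ L) :
    MvPowerSeries.coeff (Finsupp.single o 1) (r * a) =
      MvPowerSeries.constantCoeff r * MvPowerSeries.coeff (Finsupp.single o 1) a +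
        MvPowerSeries.coeff (Finsupp.single o 1) r * MvPowerSeries.constantCoeff a := by
  classical
  rw [MvPowerSeries.coeff_mul, Finsupp.antidiagonal_single, Finset.sum_map, Finset.Nat.antidiagonal_succ,
    Finset.sum_cons, Finset.Nat.antidiagonal_zero, Finset.map_singleton, Finset.sum_singleton]
  simp only [Function.Embedding.coe_prodMap, Function.Embedding.coeFn_mk, Prod.map_apply,
    Function.Embedding.refl_apply, Finsupp.single_zero, MvPowerSeries.coeff_zero_eq_constantCoeff_apply]

/-- **Descent of hyperplanarity along a ground-field extension** (Mulay 1.5: «`E` is hyperplanar iff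
`E R(x)` is hyperplanar», here for `K⟦X⟧ → L⟦X⟧`): if a regular parameter of `L⟦X⟧` lies in the
extensions of all ideals of a family `𝓔` of ideals of `K⟦X⟧`, then some regular parameter of `K⟦X⟧`
lies in all of them (one of its coordinates in a `K`-basis of `L`). [cite: Mulay1983, 1.5 p. 408] -/
theorem exists_mem_of_baseChange (𝓔 : Set (Ideal (MvPowerSeries σ K))) (zL : MvPowerSeries σ L)
    (hz0 : MvPowerSeries.constantCoeff zL = 0) (hz1 : ∃ i, MvPowerSeries.coeff (Finsupp.single i 1) zL ≠ 0)
    (hzP : ∀ P ∈ 𝓔, zL ∈ P.map (MvPowerSeries.map (algebraMap K L) : MvPowerSeries σ K →+* MvPowerSeries σ L)) :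
    ∃ z : MvPowerSeries σ K, MvPowerSeries.constantCoeff z = 0 ∧
      (∃ i, MvPowerSeries.coeff (Finsupp.single i 1) z ≠ 0) ∧ ∀ P ∈ 𝓔, z ∈ P := by
  classical
  set φ : MvPowerSeries σ K →+* MvPowerSeries σ L := MvPowerSeries.map (algebraMap K L) with hφdef
  let b := Module.Basis.ofVectorSpace K L
  -- the `j`-th coordinate of a series over `L`
  let comp : Module.Basis.ofVectorSpaceIndex K L → MvPowerSeries σ L → MvPowerSeries σ K :=
    fun j F => fun e => b.repr (F e) j
  have hcomp : ∀ j F e, MvPowerSeries.coeff e (comp j F) = b.repr (MvPowerSeries.coeff e F) j :=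
    fun j F e => rfl
  have hcomp_add : ∀ j F G, comp j (F + G) = comp j F + comp j G := by
    intro j F G; ext e; simp [hcomp]
  -- `comp j (φ i * F) = i * comp j F`
  have hcomp_mul : ∀ j (i : MvPowerSeries σ K) F, comp j (φ i * F) = i * comp j F := by
    intro j i F
    ext e
    rw [hcomp, MvPowerSeries.coeff_mul, MvPowerSeries.coeff_mul, map_sum, Finsupp.coe_finsetSum,
      Finset.sum_apply]
    refine Finset.sum_congr rfl fun x _ => ?_
    rw [hφdef, MvPowerSeries.coeff_map, ← Algebra.smul_def, map_smul, Finsupp.smul_apply, smul_eq_mul, hcomp]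
  -- membership of the coordinates
  have hmem : ∀ P ∈ 𝓔, ∀ j, comp j zL ∈ P := by
    intro P hP j
    have h := hzP P hP
    rw [Ideal.map, Submodule.mem_span_image_iff_exists_fun] at h
    obtain ⟨t, ht, c, hsum⟩ := h
    rw [← hsum]
    have : comp j (∑ i : t, c i • φ (i : MvPowerSeries σ K)) = ∑ i : t, (i : MvPowerSeries σ K) * comp j (c i) := by
      induction (Finset.univ : Finset t) using Finset.induction_on with
      | empty => ext e; simp [hcomp]
      | insert a s ha ih =>
        rw [Finset.sum_insert ha, Finset.sum_insert ha, hcomp_add, ih, smul_eq_mul, mul_comm, hcomp_mul]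
    rw [this]
    exact Ideal.sum_mem _ fun i _ => Ideal.mul_mem_right _ _ (ht i.2)
  -- a coordinate with non-zero linear term
  obtain ⟨i, hi⟩ := hz1
  obtain ⟨j, hj⟩ : ∃ j, b.repr (MvPowerSeries.coeff (Finsupp.single i 1) zL) j ≠ 0 := by
    by_contra h
    push Not at h
    exact hi (b.repr.injective (by ext j; rw [h j, map_zero, Finsupp.zero_apply]))
  refine ⟨comp j zL, ?_, ⟨i, by rwa [hcomp]⟩, fun P hP => hmem P hP j⟩
  rw [← MvPowerSeries.coeff_zero_eq_constantCoeff_apply, hcomp, MvPowerSeries.coeff_zero_eq_constantCoeff_apply,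
    hz0, map_zero, Finsupp.zero_apply]

end Descent

/-! ## 2. Invertible linear substitutions are automorphisms -/

section LinSubst

variable {L : Type u} [Field L]


/-- An invertible linear substitution `x ↦ Bx` of `L⟦x₁, …, x_n⟧` is a ring automorphism, with inverse
the substitution by `B⁻¹`. [folklore] -/
private theorem exists_ringEquiv_subst_linSubst {n : ℕ} (B : Matrix (Fin n) (Fin n) L) (hB : IsUnit B.det) :
    ∃ Ψ : MvPowerSeries (Fin n) L ≃+* MvPowerSeries (Fin n) L,
      (∀ h, Ψ h = MvPowerSeries.subst (FormalCoordChange.linSubst B) h) ∧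
        ∀ h, Ψ.symm h = MvPowerSeries.subst (FormalCoordChange.linSubst B⁻¹) h := by
  have h1 : ∀ h, MvPowerSeries.subst (FormalCoordChange.linSubst B⁻¹)
      (MvPowerSeries.subst (FormalCoordChange.linSubst B) h) = h := fun h => by
    rw [FormalCoordChange.subst_linSubst_linSubst, Matrix.mul_nonsing_inv _ hB,
      FormalCoordChange.linSubst_one, MvPowerSeries.subst_self]; rfl
  have h2 : ∀ h, MvPowerSeries.subst (FormalCoordChange.linSubst B)
      (MvPowerSeries.subst (FormalCoordChange.linSubst B⁻¹) h) = h := fun h => by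
    rw [FormalCoordChange.subst_linSubst_linSubst, Matrix.nonsing_inv_mul _ hB,
      FormalCoordChange.linSubst_one, MvPowerSeries.subst_self]; rfl
  refine ⟨{ toFun := fun h => MvPowerSeries.subst (FormalCoordChange.linSubst B) h,
             invFun := fun h => MvPowerSeries.subst (FormalCoordChange.linSubst B⁻¹) h,
             left_inv := h1, right_inv := h2,
             map_mul' := fun a b => MvPowerSeries.subst_mul (FormalCoordChange.hasSubst_linSubst B) a b,
             map_add' := fun a b => MvPowerSeries.subst_add (FormalCoordChange.hasSubst_linSubst B) a b },
    fun h => rfl, fun h => rfl⟩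

end LinSubst

/-! ## 3. The theorem over an infinite field (Mulay 2.6 + §4) -/

section Infinite

variable {L : Type u} [Field L] [Infinite L] {n : ℕ}

/-- **Mulay's Main Theorem for the smooth two-codimensional equimultiple centres of `L⟦x₀, …, x_n⟧`,
`L` infinite** (Mulay 2.6: choice of the Weierstrass direction over an infinite residue field, then §4):
if all coefficients of `g` of degree `< ν` vanish and some coefficient of degree `ν ≥ 1` does not, there is
a regular parameter `z` lying in every ideal `(u_i, u_j)` (`u` a regular system of parameters, `i ≠ j`)
with `g ∈ (u_i, u_j)^ν`. [cite: Mulay1983, 2.6 and §4 Main Theorem, pp. 410, 413] -/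
theorem exists_forall_mem_span_pair (g : MvPowerSeries (Fin (n + 1)) L) {ν : ℕ} (hν : ν ≠ 0)
    (hgν : ∀ e : Fin (n + 1) →₀ ℕ, e.degree < ν → MvPowerSeries.coeff e g = 0)
    (hgν' : ∃ e : Fin (n + 1) →₀ ℕ, e.degree = ν ∧ MvPowerSeries.coeff e g ≠ 0) :
    ∃ z : MvPowerSeries (Fin (n + 1)) L, MvPowerSeries.constantCoeff z = 0 ∧
      (∃ i, MvPowerSeries.coeff (Finsupp.single i 1) z ≠ 0) ∧
      ∀ u : Fin (n + 1) → MvPowerSeries (Fin (n + 1)) L,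
        Ideal.span (Set.range u) = maximalIdeal (MvPowerSeries (Fin (n + 1)) L) →
        ∀ i j : Fin (n + 1), i ≠ j → g ∈ Ideal.span {u i, u j} ^ ν → z ∈ Ideal.span {u i, u j} := by
  classical
  -- linear parts as functionals on `V = L^{n+1}`
  let lin : MvPowerSeries (Fin (n + 1)) L → ((Fin (n + 1) → L) →ₗ[L] L) := fun h =>
    ∑ t, MvPowerSeries.coeff (Finsupp.single t 1) h • LinearMap.proj t
  have hlin : ∀ h x, lin h x = ∑ t, MvPowerSeries.coeff (Finsupp.single t 1) h * x t := by
    intro h x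
    simp only [lin, LinearMap.coe_sum, Finset.sum_apply, LinearMap.smul_apply, LinearMap.coe_proj,
      Function.eval, smul_eq_mul]
  have hlin' : ∀ h x, (∑ᶠ s : Fin (n + 1), MvPowerSeries.coeff (Finsupp.single s 1) h * x s) = lin h x := by
    intro h x; rw [finsum_eq_sum_of_fintype, hlin]
  -- the initial form of `g`
  set inP : MvPolynomial (Fin (n + 1)) L := MvPowerSeries.truncTotal (ν + 1) g with hinP
  have hinP0 : inP ≠ 0 := by
    obtain ⟨e, he, hge⟩ := hgν'
    intro h0
    have := congrArg (MvPolynomial.coeff e) h0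
    rw [hinP, MvPowerSeries.coeff_truncTotal, MvPolynomial.coeff_zero] at this
    · exact hge this
    · rw [he]; exact Nat.lt_succ_self ν
  have hinPc : MvPolynomial.eval 0 inP = 0 := by
    rw [MvPolynomial.eval_zero, hinP]
    have : MvPolynomial.constantCoeff (MvPowerSeries.truncTotal (ν + 1) g) = MvPolynomial.coeff 0 _ := rfl
    rw [this, MvPowerSeries.coeff_truncTotal _ (by simp), ]
    exact hgν 0 (by simp; exact Nat.pos_of_ne_zero hν)
  -- admissible centres and the span `N` of their tangent planes' annihilators
  let Adm : (Fin (n + 1) → MvPowerSeries (Fin (n + 1)) L) × Fin (n + 1) × Fin (n + 1) → Prop :=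
    fun t => Ideal.span (Set.range t.1) = maximalIdeal (MvPowerSeries (Fin (n + 1)) L) ∧
      t.2.1 ≠ t.2.2 ∧ g ∈ Ideal.span {t.1 t.2.1, t.1 t.2.2} ^ ν
  let N : Submodule L (Fin (n + 1) → L) :=
    ⨆ t : {t // Adm t}, (LinearMap.ker (lin (t.1.1 t.1.2.1)) ⊓ LinearMap.ker (lin (t.1.1 t.1.2.2)))
  have hu0 : ∀ u : Fin (n + 1) → MvPowerSeries (Fin (n + 1)) L,
      Ideal.span (Set.range u) = maximalIdeal (MvPowerSeries (Fin (n + 1)) L) →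
      ∀ s, MvPowerSeries.constantCoeff (u s) = 0 := by
    intro u hu s
    exact Jets.mem_maximalIdeal_iff_constantCoeff_eq_zero.mp (hu ▸ Ideal.subset_span ⟨s, rfl⟩)
  -- invariance of the initial form along `N`
  have hNinv : ∀ w ∈ N, ∀ x, MvPolynomial.eval (x + w) inP = MvPolynomial.eval x inP := by
    intro w hw
    refine Submodule.iSup_induction _ (motive := fun w => ∀ x, MvPolynomial.eval (x + w) inP = MvPolynomial.eval x inP)
      hw ?_ ?_ ?_
    · rintro ⟨⟨u, i, j⟩, hu, hij, hgP⟩ w hw x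
      simp only [Submodule.mem_inf, LinearMap.mem_ker] at hw
      exact eval_truncTotal_add_eq_of_mem_pow (hu0 u hu i) (hu0 u hu j)
        (by rw [hlin']; exact hw.1) (by rw [hlin']; exact hw.2) hgP x
    · intro x; rw [add_zero]
    · intro w w' hw hw' x
      rw [← add_assoc, hw' (x + w), hw x]
  -- a direction `e` with `in(g)(e) ≠ 0`; it lies outside `N`
  obtain ⟨e, he⟩ : ∃ e : Fin (n + 1) → L, MvPolynomial.eval e inP ≠ 0 := by
    by_contra h
    push Not at h
    exact hinP0 (MvPolynomial.funext fun x => by rw [h x, map_zero])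
  have heN : e ∉ N := fun heN => he (by rw [← zero_add e, hNinv e heN 0, hinPc])
  -- a functional `λ` with `λ e = 1` vanishing on `N`
  obtain ⟨lam0, hlam0e, hlam0N⟩ := Submodule.exists_dual_map_eq_bot_of_notMem heN inferInstance
  set lam : Module.Dual L (Fin (n + 1) → L) := (lam0 e)⁻¹ • lam0 with hlamdef
  have hlame : lam e = 1 := by rw [hlamdef, LinearMap.smul_apply, smul_eq_mul, inv_mul_cancel₀ hlam0e]
  have hlamN : ∀ w ∈ N, lam w = 0 := by
    intro w hw
    have : lam0 w ∈ N.map lam0 := Submodule.mem_map_of_mem hw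
    rw [hlam0N, Submodule.mem_bot] at this
    rw [hlamdef, LinearMap.smul_apply, this, smul_zero]
  -- `λ` lies in every tangent plane: `λ = a ℓ_i + b ℓ_j`
  have hlamspan : ∀ (t : {t // Adm t}), ∃ a b : L, lam = a • lin (t.1.1 t.1.2.1) + b • lin (t.1.1 t.1.2.2) := by
    intro t
    have hker : ⨅ k : Fin 2, LinearMap.ker (![lin (t.1.1 t.1.2.1), lin (t.1.1 t.1.2.2)] k) ≤ LinearMap.ker lam := by
      intro w hw
      rw [LinearMap.mem_ker]
      apply hlamN
      refine Submodule.mem_iSup_of_mem t ?_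
      simp only [Submodule.mem_iInf, LinearMap.mem_ker] at hw
      exact ⟨hw 0, hw 1⟩
    have := mem_span_of_iInf_ker_le_ker hker
    rw [Submodule.mem_span_range_iff_exists_fun] at this
    obtain ⟨c, hc⟩ := this
    refine ⟨c 0, c 1, ?_⟩
    rw [← hc, Fin.sum_univ_two]
    rfl
  -- the new basis: `e` followed by a basis of `ker λ`
  have hsurj : LinearMap.range lam = ⊤ := by
    rw [eq_top_iff]
    rintro c -
    exact ⟨c • e, by rw [map_smul, hlame, smul_eq_mul, mul_one]⟩
  have hker_rank : Module.finrank L (LinearMap.ker lam) = n := by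
    have h := LinearMap.finrank_range_add_finrank_ker lam
    rw [hsurj, finrank_top, Module.finrank_self, Module.finrank_fin_fun] at h
    omega
  let bH := Module.finBasisOfFinrankEq L (LinearMap.ker lam) hker_rank
  let col : Fin (n + 1) → (Fin (n + 1) → L) := Fin.cons e fun k => (bH k : Fin (n + 1) → L)
  have hcol0 : col 0 = e := Fin.cons_zero _ _
  have hcolS : ∀ k : Fin n, col k.succ = (bH k : Fin (n + 1) → L) := fun k => Fin.cons_succ _ _ k
  have hlamcol : ∀ t : Fin (n + 1), lam (col t) = if t = 0 then 1 else 0 := by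
    intro t
    refine Fin.cases ?_ (fun k => ?_) t
    · rw [hcol0, hlame, if_pos rfl]
    · rw [hcolS, if_neg (Fin.succ_ne_zero k)]
      exact (bH k).2
  have hind : LinearIndependent L col := by
    rw [linearIndependent_finCons]
    refine ⟨(bH.linearIndependent.map' (LinearMap.ker lam).subtype (Submodule.ker_subtype _)), fun hmem => ?_⟩
    have hle : Submodule.span L (Set.range fun k => (bH k : Fin (n + 1) → L)) ≤ LinearMap.ker lam := by
      rw [Submodule.span_le]
      rintro _ ⟨k, rfl⟩
      exact (bH k).2
    have := hle hmem
    rw [LinearMap.mem_ker, hlame] at this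
    exact one_ne_zero this
  let B : Matrix (Fin (n + 1)) (Fin (n + 1)) L := fun s t => col t s
  have hBcol : ∀ t, (fun s => B s t) = col t := fun t => rfl
  have hBdet : IsUnit B.det := by
    rw [← Matrix.isUnit_iff_isUnit_det, ← Matrix.linearIndependent_cols_iff_isUnit]
    exact hind
  -- the change of coordinates `Ψ : h ↦ h(Bx)` and the renaming `Θ : x₀ ↦ x_none`
  obtain ⟨Ψ, hΨ, hΨsymm⟩ := exists_ringEquiv_subst_linSubst B hBdet
  let ρ : Fin (n + 1) ≃ Option (Fin n) := finSuccEquiv n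
  let Θ : MvPowerSeries (Fin (n + 1)) L ≃ₐ[L] MvPowerSeries (Option (Fin n)) L := MvPowerSeries.renameEquiv L ρ
  have hΘ : ∀ h, Θ h = MvPowerSeries.rename ρ.toEmbedding h := fun h => rfl
  -- coefficients after `Ψ` and `Θ`
  have hΨlin : ∀ (h : MvPowerSeries (Fin (n + 1)) L), MvPowerSeries.constantCoeff h = 0 → ∀ t,
      MvPowerSeries.coeff (Finsupp.single t 1) (Ψ h) = lin h (col t) := by
    intro h hh t
    rw [hΨ, coeff_single_subst_linSubst B (m := 1) (fun e he => by
      rw [(Finsupp.degree_eq_zero_iff e).mp (by omega), MvPowerSeries.coeff_zero_eq_constantCoeff_apply, hh]) t,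
      eval_truncTotal_two hh, hlin']
  have hΨν : MvPowerSeries.coeff (Finsupp.single 0 ν) (Ψ g) = MvPolynomial.eval e inP := by
    rw [hΨ, coeff_single_subst_linSubst B hgν 0, hBcol, hcol0]
  have hΨconst : ∀ h, MvPowerSeries.constantCoeff h = 0 → MvPowerSeries.constantCoeff (Ψ h) = 0 := by
    intro h hh
    rw [hΨ]
    exact MvPowerSeries.constantCoeff_subst_eq_zero (FormalCoordChange.hasSubst_linSubst B)
      (fun i => by simp [FormalCoordChange.linSubst, map_sum, MvPowerSeries.constantCoeff_X]) hh
  have hΨpow : ∀ (m : ℕ) (h : MvPowerSeries (Fin (n + 1)) L),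
      h ∈ maximalIdeal (MvPowerSeries (Fin (n + 1)) L) ^ m → Ψ h ∈ maximalIdeal (MvPowerSeries (Fin (n + 1)) L) ^ m := by
    intro m h hh
    rw [hΨ, ← MvPowerSeries.substAlgHom_apply (FormalCoordChange.hasSubst_linSubst B)]
    exact Jets.algHom_apply_mem_maximalIdeal_pow _ hh
  have hΘconst : ∀ h, MvPowerSeries.constantCoeff (Θ h) = MvPowerSeries.constantCoeff h := fun h => by
    rw [hΘ, MvPowerSeries.constantCoeff_rename]
  have hΘnone : ∀ h (m : ℕ), MvPowerSeries.coeff (Finsupp.single none m) (Θ h) = MvPowerSeries.coeff (Finsupp.single 0 m) h := by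
    intro h m
    rw [hΘ, ← finSuccEquiv_zero, show (Finsupp.single ((finSuccEquiv n) 0) m : Option (Fin n) →₀ ℕ) =
      Finsupp.embDomain ρ.toEmbedding (Finsupp.single 0 m) from by rw [Finsupp.embDomain_single]; rfl]
    exact MvPowerSeries.coeff_embDomain_rename ρ.toEmbedding h (Finsupp.single 0 m)
  have hΘsome : ∀ h (k : Fin n), MvPowerSeries.coeff (Finsupp.single (some k) 1) (Θ h) =
      MvPowerSeries.coeff (Finsupp.single k.succ 1) h := by
    intro h k
    rw [hΘ, ← finSuccEquiv_succ, show (Finsupp.single ((finSuccEquiv n) k.succ) 1 : Option (Fin n) →₀ ℕ) =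
      Finsupp.embDomain ρ.toEmbedding (Finsupp.single k.succ 1) from by rw [Finsupp.embDomain_single]; rfl]
    exact MvPowerSeries.coeff_embDomain_rename ρ.toEmbedding h (Finsupp.single k.succ 1)
  have hΘdeg : ∀ h (E : Option (Fin n) →₀ ℕ) (m : ℕ), (∀ e : Fin (n + 1) →₀ ℕ, e.degree < m → MvPowerSeries.coeff e h = 0) →
      E.degree < m → MvPowerSeries.coeff E (Θ h) = 0 := by
    intro h E m hh hE
    rw [hΘ, MvPowerSeries.coeff_rename]
    refine Finset.sum_eq_zero fun e he => hh e ?_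
    rw [Set.Finite.mem_toFinset, Set.mem_preimage, Set.mem_singleton_iff] at he
    rw [← he, Finsupp.degree_mapDomain] at hE
    exact hE
  -- the core theorem in the new coordinates
  set g'' : MvPowerSeries (Option (Fin n)) L := Θ (Ψ g) with hg''
  have hgm : g ∈ maximalIdeal (MvPowerSeries (Fin (n + 1)) L) ^ ν := Jets.mem_maximalIdeal_pow_of_coeff_eq_zero hgν
  have hg''ν : ∀ E : Option (Fin n) →₀ ℕ, E.degree < ν → MvPowerSeries.coeff E g'' = 0 := fun E hE =>
    hΘdeg (Ψ g) E ν (fun e he => Jets.coeff_eq_zero_of_mem_maximalIdeal_pow (hΨpow ν g hgm) he) hE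
  have hg''T : MvPowerSeries.coeff (Finsupp.single none ν) g'' ≠ 0 := by
    rw [hg'', hΘnone, hΨν]; exact he
  obtain ⟨ζ, hζ0, ⟨o, hζo⟩, hζ⟩ := exists_forall_mem_of_smooth hν g'' hg''ν hg''T
  -- transport back
  set z : MvPowerSeries (Fin (n + 1)) L := Ψ.symm (Θ.symm ζ) with hzdef
  have hz0 : MvPowerSeries.constantCoeff z = 0 := by
    rw [hzdef, hΨsymm]
    refine MvPowerSeries.constantCoeff_subst_eq_zero (FormalCoordChange.hasSubst_linSubst B⁻¹)
      (fun i => by simp [FormalCoordChange.linSubst, map_sum, MvPowerSeries.constantCoeff_X]) ?_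
    have : Θ.symm ζ = MvPowerSeries.rename ρ.symm ζ := rfl
    rw [this, MvPowerSeries.constantCoeff_rename, hζ0]
  have hz1 : ∃ i, MvPowerSeries.coeff (Finsupp.single i 1) z ≠ 0 := by
    by_contra hnone
    push Not at hnone
    have hz2 : z ∈ maximalIdeal (MvPowerSeries (Fin (n + 1)) L) ^ 2 := by
      refine Jets.mem_maximalIdeal_pow_of_coeff_eq_zero fun e he => ?_
      rcases FormalCoordChange.eq_zero_or_single_of_degree_lt_two e he with rfl | ⟨i, rfl⟩
      · rw [MvPowerSeries.coeff_zero_eq_constantCoeff_apply, hz0]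
      · exact hnone i
    have hΨz : Ψ z ∈ maximalIdeal (MvPowerSeries (Fin (n + 1)) L) ^ 2 := hΨpow 2 z hz2
    have hΨz' : Ψ z = Θ.symm ζ := by rw [hzdef, RingEquiv.apply_symm_apply]
    have hcoef : ∀ t, MvPowerSeries.coeff (Finsupp.single t 1) (Θ.symm ζ) = 0 := fun t => by
      rw [← hΨz']; exact Jets.coeff_eq_zero_of_mem_maximalIdeal_pow hΨz (by simp)
    apply hζo
    have hζ' : ζ = Θ (Θ.symm ζ) := (AlgEquiv.apply_symm_apply Θ ζ).symm
    rw [hζ']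
    cases o with
    | none => rw [hΘnone, hcoef]
    | some k => rw [hΘsome, hcoef]
  refine ⟨z, hz0, hz1, fun u hu i j hij hgP => ?_⟩
  -- the centre `(u_i, u_j)` in the new coordinates
  have hadm : Adm ⟨u, i, j⟩ := ⟨hu, hij, hgP⟩
  obtain ⟨a, b, hab⟩ := hlamspan ⟨⟨u, i, j⟩, hadm⟩
  simp only at hab
  -- the generator with linear part `x₀`
  set w : MvPowerSeries (Fin (n + 1)) L := MvPowerSeries.C a * u i + MvPowerSeries.C b * u j with hwdef
  have hwmem : w ∈ Ideal.span {u i, u j} :=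
    Ideal.add_mem _ (Ideal.mul_mem_left _ _ (Ideal.subset_span (by simp)))
      (Ideal.mul_mem_left _ _ (Ideal.subset_span (by simp)))
  have hw0 : MvPowerSeries.constantCoeff w = 0 := by
    rw [hwdef, map_add, map_mul, map_mul, hu0 u hu i, hu0 u hu j, mul_zero, mul_zero, add_zero]
  have hwlin : lin w = lam := by
    rw [hab]
    apply LinearMap.ext; intro x
    rw [hlin, LinearMap.add_apply, LinearMap.smul_apply, LinearMap.smul_apply, hlin, hlin, smul_eq_mul, smul_eq_mul,
      Finset.mul_sum, Finset.mul_sum, ← Finset.sum_add_distrib]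
    refine Finset.sum_congr rfl fun t _ => ?_
    rw [hwdef, map_add, coeff_single_one_mul', coeff_single_one_mul', hu0 u hu i, hu0 u hu j,
      MvPowerSeries.constantCoeff_C, MvPowerSeries.constantCoeff_C, MvPowerSeries.coeff_C, MvPowerSeries.coeff_C,
      if_neg (Finsupp.single_ne_zero.mpr one_ne_zero), if_neg (Finsupp.single_ne_zero.mpr one_ne_zero)]
    ring
  -- linear independence of the linear parts of a regular system of parameters
  have hlinind : ∀ (c₁ c₂ : L), c₁ • lin (u i) + c₂ • lin (u j) = 0 → c₁ = 0 ∧ c₂ = 0 := by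
    -- the family `lin ∘ u` spans the dual space, hence is linearly independent
    have hspan : ⊤ ≤ Submodule.span L (Set.range fun s => lin (u s)) := by
      -- `proj t = Σ_s c_s(0) • lin (u s)` where `Σ c_s u_s = X_t`
      have hproj : ∀ t : Fin (n + 1), (LinearMap.proj t : (Fin (n + 1) → L) →ₗ[L] L) ∈
          Submodule.span L (Set.range fun s => lin (u s)) := by
        intro t
        have hXt : (MvPowerSeries.X t : MvPowerSeries (Fin (n + 1)) L) ∈ Ideal.span (Set.range u) := by
          rw [hu]; exact Jets.mem_maximalIdeal_iff_constantCoeff_eq_zero.mpr (MvPowerSeries.constantCoeff_X t)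
        obtain ⟨c, hc⟩ := (Submodule.mem_span_range_iff_exists_fun (MvPowerSeries (Fin (n + 1)) L)).mp hXt
        have hct : ∀ r, ∑ s, MvPowerSeries.constantCoeff (c s) * MvPowerSeries.coeff (Finsupp.single r 1) (u s) =
            if r = t then 1 else 0 := by
          intro r
          have := congrArg (MvPowerSeries.coeff (Finsupp.single r 1)) hc
          rw [map_sum, MvPowerSeries.coeff_index_single_X] at this
          rw [← this]
          refine Finset.sum_congr rfl fun s _ => ?_
          rw [smul_eq_mul, coeff_single_one_mul', hu0 u hu s, mul_zero, add_zero]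
        have hrepr : (LinearMap.proj t : (Fin (n + 1) → L) →ₗ[L] L) =
            ∑ s, MvPowerSeries.constantCoeff (c s) • lin (u s) := by
          apply LinearMap.ext; intro x
          rw [LinearMap.sum_apply]
          simp_rw [LinearMap.smul_apply, hlin, smul_eq_mul, Finset.mul_sum]
          rw [Finset.sum_comm]
          have : ∀ r, ∑ s, MvPowerSeries.constantCoeff (c s) * (MvPowerSeries.coeff (Finsupp.single r 1) (u s) * x r) =
              (if r = t then 1 else 0) * x r := fun r => by
            rw [← hct r, Finset.sum_mul]
            exact Finset.sum_congr rfl fun s _ => by ring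
          simp_rw [this]
          simp
        rw [hrepr]
        exact Submodule.sum_mem _ fun s _ => Submodule.smul_mem _ _ (Submodule.subset_span ⟨s, rfl⟩)
      intro f _
      have hf : f = ∑ t, f (Pi.single t 1) • (LinearMap.proj t : (Fin (n + 1) → L) →ₗ[L] L) := by
        apply LinearMap.ext; intro x
        rw [LinearMap.sum_apply]
        simp only [LinearMap.smul_apply, LinearMap.coe_proj, Function.eval, smul_eq_mul]
        conv_lhs => rw [show x = ∑ t, x t • (Pi.single t 1 : Fin (n + 1) → L) from by
          ext s; simp [Finset.sum_apply, Pi.single_apply]]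
        rw [map_sum]
        exact Finset.sum_congr rfl fun t _ => by rw [map_smul, smul_eq_mul, mul_comm]
      rw [hf]
      exact Submodule.sum_mem _ fun t _ => Submodule.smul_mem _ _ (hproj t)
    have hli : LinearIndependent L fun s => lin (u s) :=
      linearIndependent_of_top_le_span_of_card_eq_finrank hspan (by
        rw [Fintype.card_fin, Subspace.dual_finrank_eq, Module.finrank_fin_fun])
    intro c₁ c₂ hc
    have := (Fintype.linearIndependent_iff.mp hli) (Pi.single i c₁ + Pi.single j c₂) (by
      rw [← hc]
      simp only [Pi.add_apply, add_smul, Finset.sum_add_distrib]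
      rw [Finset.sum_eq_single i, Finset.sum_eq_single j]
      · simp
      · intro s _ hs; rw [Pi.single_eq_of_ne hs, zero_smul]
      · intro h; exact absurd (Finset.mem_univ j) h
      · intro s _ hs; rw [Pi.single_eq_of_ne hs, zero_smul]
      · intro h; exact absurd (Finset.mem_univ i) h)
    refine ⟨by simpa [hij] using this i, by simpa [hij.symm] using this j⟩
  -- the second generator `v`
  obtain ⟨v, hvmem, hvspan, hvlin⟩ : ∃ v : MvPowerSeries (Fin (n + 1)) L, v ∈ Ideal.span {u i, u j} ∧
      Ideal.span {w, v} = Ideal.span {u i, u j} ∧ ∃ k : Fin n, lin v (col k.succ) ≠ 0 := by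
    -- a functional vanishing on `ker λ` is a multiple of `λ`
    have hmult : ∀ h : MvPowerSeries (Fin (n + 1)) L, (∀ k : Fin n, lin h (col k.succ) = 0) → lin h = lin h e • lam := by
      intro h hk
      have hker : ⨅ k : Fin 1, LinearMap.ker (![lam] k) ≤ LinearMap.ker (lin h) := by
        intro x hx
        simp only [Submodule.mem_iInf, LinearMap.mem_ker] at hx
        have hx0 : lam x = 0 := hx 0
        rw [LinearMap.mem_ker]
        -- write `x` in the basis `col`
        have hxmem : x ∈ Submodule.span L (Set.range fun k : Fin n => (bH k : Fin (n + 1) → L)) := by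
          have : x ∈ LinearMap.ker lam := hx0
          have hx' : (⟨x, this⟩ : LinearMap.ker lam) ∈ Submodule.span L (Set.range bH) := by
            rw [bH.span_eq]; trivial
          have := Submodule.mem_map_of_mem (f := (LinearMap.ker lam).subtype) hx'
          rw [Submodule.map_span, ← Set.range_comp] at this
          exact this
        rw [Submodule.mem_span_range_iff_exists_fun] at hxmem
        obtain ⟨c, rfl⟩ := hxmem
        rw [map_sum]
        refine Finset.sum_eq_zero fun k _ => ?_
        rw [map_smul, ← hcolS, hk k, smul_zero]
      have := mem_span_of_iInf_ker_le_ker hker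
      rw [Submodule.mem_span_range_iff_exists_fun] at this
      obtain ⟨c, hc⟩ := this
      rw [Fin.sum_univ_one] at hc
      have hc' : lin h = c 0 • lam := by rw [← hc]; simp
      have hce : c 0 = lin h e := by rw [hc', LinearMap.smul_apply, hlame, smul_eq_mul, mul_one]
      conv_lhs => rw [hc']
      rw [hce]
    by_cases ha : a = 0
    · -- `λ = b ℓ_j`, take `v = u_i`
      have hb : b ≠ 0 := by
        rintro rfl
        rw [ha, zero_smul, zero_smul, add_zero] at hab
        exact one_ne_zero (by rw [← hlame, hab, LinearMap.zero_apply])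
      refine ⟨u i, Ideal.subset_span (by simp), ?_, ?_⟩
      · rw [hwdef, ha, map_zero, zero_mul, zero_add, Ideal.span_pair_comm]
        have : Ideal.span {u i, MvPowerSeries.C b * u j} = Ideal.span {u i, u j} := by
          apply le_antisymm
          · rw [Ideal.span_le]; rintro x hx
            simp only [Set.mem_insert_iff, Set.mem_singleton_iff] at hx
            rcases hx with rfl | rfl
            · exact Ideal.subset_span (by simp)
            · exact Ideal.mul_mem_left _ _ (Ideal.subset_span (by simp))
          · rw [Ideal.span_le]; rintro x hx
            simp only [Set.mem_insert_iff, Set.mem_singleton_iff] at hx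
            rcases hx with rfl | rfl
            · exact Ideal.subset_span (by simp)
            · exact Ideal.mem_span_pair.mpr ⟨0, MvPowerSeries.C b⁻¹, by
                rw [zero_mul, zero_add, ← mul_assoc, ← map_mul, inv_mul_cancel₀ hb, map_one, one_mul]⟩
        exact this
      · by_contra hk
        push Not at hk
        have h1 := hmult (u i) hk
        rw [hab, ha, zero_smul, zero_add, smul_smul] at h1
        have := hlinind 1 (-(lin (u i) e * b)) (by
          apply LinearMap.ext; intro x
          have hx := congrArg (fun f => f x) h1
          simp only [LinearMap.add_apply, LinearMap.smul_apply, smul_eq_mul, LinearMap.zero_apply] at hx ⊢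
          linear_combination hx)
        exact one_ne_zero this.1
    · -- `a ≠ 0`, take `v = u_j`
      refine ⟨u j, Ideal.subset_span (by simp), ?_, ?_⟩
      · apply le_antisymm
        · rw [Ideal.span_le]; rintro x hx
          simp only [Set.mem_insert_iff, Set.mem_singleton_iff] at hx
          rcases hx with rfl | rfl
          · exact hwmem
          · exact Ideal.subset_span (by simp)
        · rw [Ideal.span_le]; rintro x hx
          simp only [Set.mem_insert_iff, Set.mem_singleton_iff] at hx
          rcases hx with rfl | rfl
          · exact Ideal.mem_span_pair.mpr ⟨MvPowerSeries.C a⁻¹, -(MvPowerSeries.C a⁻¹ * MvPowerSeries.C b), by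
              rw [hwdef, mul_add, ← mul_assoc, ← map_mul, inv_mul_cancel₀ ha, map_one, one_mul]; ring⟩
          · exact Ideal.subset_span (by simp)
      · by_contra hk
        push Not at hk
        have h1 := hmult (u j) hk
        rw [hab, smul_add, smul_smul, smul_smul] at h1
        have := hlinind (lin (u j) e * a) (lin (u j) e * b - 1) (by
          apply LinearMap.ext; intro x
          have hx := congrArg (fun f => f x) h1
          simp only [LinearMap.add_apply, LinearMap.smul_apply, smul_eq_mul, LinearMap.zero_apply] at hx ⊢
          linear_combination -hx)
        exact ha (by
          rcases mul_eq_zero.mp this.1 with h | h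
          · have h2 := this.2; rw [h, zero_mul, zero_sub] at h2; exact absurd h2 (by norm_num)
          · exact h)
  obtain ⟨k, hk⟩ := hvlin
  -- hypotheses of the core theorem for `(Θ Ψ w, Θ Ψ v)`
  set w'' := Θ (Ψ w) with hw''
  set v'' := Θ (Ψ v) with hv''
  have hv0 : MvPowerSeries.constantCoeff v = 0 := by
    have : Ideal.span {u i, u j} ≤ maximalIdeal _ := by
      rw [← hu]; apply Ideal.span_mono
      rintro x hx; simp only [Set.mem_insert_iff, Set.mem_singleton_iff] at hx
      rcases hx with rfl | rfl
      · exact ⟨i, rfl⟩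
      · exact ⟨j, rfl⟩
    exact Jets.mem_maximalIdeal_iff_constantCoeff_eq_zero.mp (this hvmem)
  have hw''0 : MvPowerSeries.constantCoeff w'' = 0 := by rw [hw'', hΘconst, hΨconst w hw0]
  have hw''1 : MvPowerSeries.coeff (Finsupp.single none 1) w'' = 1 := by
    rw [hw'', hΘnone, hΨlin w hw0, hwlin, hlamcol, if_pos rfl]
  have hw''s : ∀ s : Fin n, MvPowerSeries.coeff (Finsupp.single (some s) 1) w'' = 0 := fun s => by
    rw [hw'', hΘsome, hΨlin w hw0, hwlin, hlamcol, if_neg (Fin.succ_ne_zero s)]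
  have hv''0 : MvPowerSeries.constantCoeff v'' = 0 := by rw [hv'', hΘconst, hΨconst v hv0]
  have hv''s : ∃ s : Fin n, MvPowerSeries.coeff (Finsupp.single (some s) 1) v'' ≠ 0 :=
    ⟨k, by rw [hv'', hΘsome, hΨlin v hv0]; exact hk⟩
  -- `g'' ∈ (w'', v'')^ν`
  let ΘΨ : MvPowerSeries (Fin (n + 1)) L →+* MvPowerSeries (Option (Fin n)) L :=
    Θ.toRingEquiv.toRingHom.comp Ψ.toRingHom
  have hΘΨ : ∀ h, ΘΨ h = Θ (Ψ h) := fun h => rfl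
  have hmapP : (Ideal.span {u i, u j}).map ΘΨ = Ideal.span {w'', v''} := by
    rw [← hvspan, Ideal.map_span, Set.image_pair]
    rfl
  have hg''P : g'' ∈ Ideal.span {w'', v''} ^ ν := by
    rw [← hmapP, ← Ideal.map_pow, hg'']
    exact Ideal.mem_map_of_mem ΘΨ hgP
  have hζmem := hζ w'' v'' hw''0 hw''1 hw''s hv''0 hv''s hg''P
  -- pull back
  rw [← hvspan]
  have hback : ∀ x : MvPowerSeries (Option (Fin n)) L, x ∈ Ideal.span {w'', v''} →
      Ψ.symm (Θ.symm x) ∈ Ideal.span {w, v} := by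
    intro x hx
    rw [← hmapP] at hx
    let ΘΨe : MvPowerSeries (Fin (n + 1)) L ≃+* MvPowerSeries (Option (Fin n)) L := Ψ.trans Θ.toRingEquiv
    have h1 : (Ideal.span {u i, u j}).map ΘΨ = (Ideal.span {u i, u j}).map ΘΨe.toRingHom := rfl
    rw [h1] at hx
    have h2 : ΘΨe.symm.toRingHom x ∈ ((Ideal.span {u i, u j}).map ΘΨe.toRingHom).map ΘΨe.symm.toRingHom :=
      Ideal.mem_map_of_mem _ hx
    have h3 : ΘΨe.symm.toRingHom.comp ΘΨe.toRingHom = RingHom.id _ := by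
      ext y; simp
    rw [Ideal.map_map, h3, Ideal.map_id] at h2
    rw [hvspan]
    exact h2
  exact hback ζ hζmem

end Infinite

end Mulay1983

/-! ## 4. The discharge -/

/-- **DISCHARGE of the named fact `Mulay1983_codimTwoHyperplanar`** (S. B. Mulay, *Equimultiplicity and
hyperplanarity*, Proc. AMS 89 (1983), §4 Main Theorem with §1.3, in the typed special case
`R = K⟦X_{Fin d}⟧`, centres cut out by two members of a regular system of parameters): for `g ≠ 0` in `𝔪`
there is ONE regular parameter `z ∈ 𝔪 ∖ 𝔪²` lying in every `(u_i, u_j)` with `g ∈ (u_i, u_j)^{ord g}`.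
Proof: base change to the algebraic closure (1.5), `exists_forall_mem_span_pair` (2.6 + §4), descent
(`exists_mem_of_baseChange`). [cite: Mulay1983, §4 Main Theorem and Corollary p. 413; §1.3 p. 408] -/
theorem Mulay1983_codimTwoHyperplanar_holds : Mulay1983_codimTwoHyperplanar.{u} := by
  intro K _ d g hg0 hgm
  classical
  -- `d = 0` is impossible: the only series in `𝔪` is `0`
  cases d with
  | zero =>
    exfalso
    apply hg0
    ext e
    rw [Subsingleton.elim e 0, MvPowerSeries.coeff_zero_eq_constantCoeff_apply, map_zero]
    exact Jets.mem_maximalIdeal_iff_constantCoeff_eq_zero.mp hgm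
  | succ n =>
  haveI : IsRegularLocalRing (MvPowerSeries (Fin (n + 1)) K) := isRegularLocalRing_mvPowerSeries K (Fin (n + 1))
  -- the order `ν ≥ 1` of `g`
  set ν : ℕ := (adicOrder g).toNat with hνdef
  have hνeq : adicOrder g = ν := (ENat.coe_toNat (adicOrder_ne_top hg0)).symm
  have hgpow : g ∈ maximalIdeal (MvPowerSeries (Fin (n + 1)) K) ^ ν :=
    (le_adicOrder_iff g ν).mp (le_of_eq hνeq.symm)
  have hν : ν ≠ 0 := by
    intro h0
    have h1 : ((1 : ℕ) : ℕ∞) ≤ adicOrder g := (le_adicOrder_iff g 1).mpr (by rwa [pow_one])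
    rw [hνeq, h0] at h1
    exact absurd h1 (by decide)
  have hgν : ∀ e : Fin (n + 1) →₀ ℕ, e.degree < ν → MvPowerSeries.coeff e g = 0 := fun e he =>
    Jets.coeff_eq_zero_of_mem_maximalIdeal_pow hgpow he
  have hgν' : ∃ e : Fin (n + 1) →₀ ℕ, e.degree = ν ∧ MvPowerSeries.coeff e g ≠ 0 := by
    have hnot : g ∉ maximalIdeal (MvPowerSeries (Fin (n + 1)) K) ^ (ν + 1) :=
      (adicOrder_le_iff g ν).mp (le_of_eq hνeq)
    by_contra hcon
    push Not at hcon
    exact hnot (Jets.mem_maximalIdeal_pow_of_coeff_eq_zero fun e he => by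
      by_cases hlt : e.degree < ν
      · exact hgν e hlt
      · exact hcon e (by omega))
  -- base change to the algebraic closure `L` (Mulay 1.5)
  let L := AlgebraicClosure K
  let φ : MvPowerSeries (Fin (n + 1)) K →+* MvPowerSeries (Fin (n + 1)) L := MvPowerSeries.map (algebraMap K L)
  have hφcoeff : ∀ h e, MvPowerSeries.coeff e (φ h) = algebraMap K L (MvPowerSeries.coeff e h) := fun h e =>
    MvPowerSeries.coeff_map _ _ _
  have hφinj : Function.Injective (algebraMap K L) := (algebraMap K L).injective
  set gL := φ g with hgLdef
  have hgLν : ∀ e : Fin (n + 1) →₀ ℕ, e.degree < ν → MvPowerSeries.coeff e gL = 0 := fun e he => by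
    rw [hgLdef, hφcoeff, hgν e he, map_zero]
  have hgLν' : ∃ e : Fin (n + 1) →₀ ℕ, e.degree = ν ∧ MvPowerSeries.coeff e gL ≠ 0 := by
    obtain ⟨e, he, hge⟩ := hgν'
    exact ⟨e, he, fun h => hge (hφinj (by rw [← hφcoeff, ← hgLdef, h, map_zero]))⟩
  obtain ⟨zL, hzL0, hzL1, hzL⟩ := Mulay1983.exists_forall_mem_span_pair gL hν hgLν hgLν'
  -- the family of centres, and the extension of each to `L`
  let 𝓔 : Set (Ideal (MvPowerSeries (Fin (n + 1)) K)) := {P | ∃ (u : Fin (n + 1) → MvPowerSeries (Fin (n + 1)) K)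
    (i j : Fin (n + 1)), Ideal.span (Set.range u) = maximalIdeal _ ∧ i ≠ j ∧ g ∈ Ideal.span {u i, u j} ^ ν ∧
      P = Ideal.span {u i, u j}}
  have hext : ∀ P ∈ 𝓔, zL ∈ P.map φ := by
    rintro P ⟨u, i, j, hu, hij, hgP, rfl⟩
    have hu0 : ∀ s, MvPowerSeries.constantCoeff (u s) = 0 := fun s =>
      Jets.mem_maximalIdeal_iff_constantCoeff_eq_zero.mp (hu ▸ Ideal.subset_span ⟨s, rfl⟩)
    -- `φ ∘ u` is a regular system of parameters over `L`
    have huL : Ideal.span (Set.range (φ ∘ u)) = maximalIdeal (MvPowerSeries (Fin (n + 1)) L) := by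
      apply le_antisymm
      · rw [Ideal.span_le]
        rintro _ ⟨s, rfl⟩
        rw [SetLike.mem_coe, Jets.mem_maximalIdeal_iff_constantCoeff_eq_zero, Function.comp_apply,
          MvPowerSeries.constantCoeff_map, hu0 s, map_zero]
      · rw [maximalIdeal_mvPowerSeries_eq_span L (Fin (n + 1)), Ideal.span_le]
        rintro _ ⟨t, rfl⟩
        have hXt : (MvPowerSeries.X t : MvPowerSeries (Fin (n + 1)) K) ∈ Ideal.span (Set.range u) := by
          rw [hu]; exact Jets.mem_maximalIdeal_iff_constantCoeff_eq_zero.mpr (MvPowerSeries.constantCoeff_X t)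
        have := Ideal.mem_map_of_mem φ hXt
        rw [MvPowerSeries.map_X, Ideal.map_span, ← Set.range_comp] at this
        exact this
    have hgLP : gL ∈ Ideal.span {(φ ∘ u) i, (φ ∘ u) j} ^ ν := by
      have := Ideal.mem_map_of_mem φ hgP
      rw [Ideal.map_pow, Ideal.map_span, Set.image_pair] at this
      exact this
    have hmem := hzL (φ ∘ u) huL i j hij hgLP
    rw [Ideal.map_span, Set.image_pair]
    exact hmem
  obtain ⟨z, hz0, ⟨i₀, hzi₀⟩, hzP⟩ := Mulay1983.exists_mem_of_baseChange 𝓔 zL hzL0 hzL1 hext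
  refine ⟨z, Jets.mem_maximalIdeal_iff_constantCoeff_eq_zero.mpr hz0,
    fun h2 => hzi₀ (Jets.coeff_eq_zero_of_mem_maximalIdeal_pow h2 (by simp)), ?_⟩
  intro u hu S hS hgS
  obtain ⟨i, j, hij, rfl⟩ := Finset.card_eq_two.mp hS
  have hset : u '' ((({i, j} : Finset (Fin (n + 1))) : Set (Fin (n + 1)))) = {u i, u j} := by
    rw [Finset.coe_pair, Set.image_pair]
  rw [hset] at hgS ⊢
  exact hzP _ ⟨u, i, j, hu, hij, hgS, rfl⟩


end Literature.AlgebraicGeometry.Resolution
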